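import Literature.NumberTheory.Automorphic.AutomorphicRepsGLCuspidalL2Step1Bump
import HarnessLib

/-!
# `Ad K_∞`-invariant symmetric test functions on `GL_n(𝔸_K)` of PRESCRIBED level and
archimedean support (Bump (1997), proof of Lemma 2.3.2; Getz–Hahn (2024), §9.3, Exercise 9.7)

Topic `NumberTheory/Automorphic`; a refinement of `AutomorphicRepsGLCuspidalL2Step1Bump`, which
proves W1 (`AutomorphicRepsGL.exists_adInvariant_symmetric_testWeight_holds`): every neighbourhood
of `1` in `GL_n(𝔸_K)` supports a non-negative symmetric `Ad K_∞`-invariant test function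
`η(g) = φ(Q(g_∞ - 1)) φ(Q(g_∞⁻¹ - 1)) · 1_{K_f(𝔫)}(g_f)` (`archBump`, the Hilbert–Schmidt form `hsQ`),
left invariant under SOME principal congruence level `K(𝔫)`.

Delta against Step1Bump (the only new content, `exists_adInvariant_isTestFunctionGL`): the level
is PRESCRIBED — for every compact open `U₀ ≤ GL_n(𝔸_K^∞)` and every neighbourhood `V` of `1` in
`GL_n(K_∞)` the function `η(g) = archBump φ (g_∞) · 1_{U₀}(g_f)` is a test function
(`IsTestFunctionGL`) which is `≥ 0`, `= 1` at `1`, symmetric, `Ad K_∞`-invariant, left AND right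
invariant under `{1} × U₀`, and satisfies `η(g) ≠ 0 ⟹ g_∞ ∈ V ∧ g_f ∈ U₀`. This is the form needed
by approximate-identity arguments at a FIXED level `U` (Getz–Hahn (2024), proof of Lemma 9.8.2,
printed p. 192: "every vector `φ ∈ V_fin` is fixed by a compact open subgroup `K' ≤ K`, so
`π(1_{K'}) φ = φ`"; Bump (1997), proof of Lemma 2.3.2, PDF p. 163), where W1's `∃ U` does not
suffice. The proof is the assembly of Step1Bump with `K_f(𝔫)` replaced by `U₀` and the archimedean
radius chosen inside `V`; nothing of Step1Bump is restated.

## References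

* D. Bump, *Automorphic Forms and Representations* (1997), proof of Lemma 2.3.2 (PDF p. 163)
  [Bump1997].
* J. R. Getz, H. Hahn, *An Introduction to Automorphic Representations*, GTM 300 (2024), §9.3
  (Dirac sequences, Exercise 9.7, printed p. 179), Lemma 9.8.2 and its proof (printed pp. 191–192)
  [GetzHahn2024].
-/

-- Mathlib idiom (Mathlib/Algebra/Lie/OfAssociative.lean); needed to mention Lie subalgebras of matrix algebras
attribute [local instance 100] LieRing.ofAssociativeRing

open scoped MatrixGroups Matrix ContDiff Classical Topology Pointwise
open NumberField NumberField.mixedEmbedding IsDedekindDomain Filter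
open _root_.MeasureTheory

noncomputable section

namespace Literature.NumberTheory.Automorphic

-- `M_n(K ⊗ ℝ)` is finite-dimensional over `ℝ` (the tree's instance, as in
-- `GLnCuspidalSpectrumSiegelProofs` and `AutomorphicRepsGLCuspidalL2Step1Bump`)
attribute [local instance] finiteDimensional_matrix_mixedSpace

variable {n : ℕ} {K : Type} [Field K] [NumberField K]

-- the scoped operator norm on `𝔤𝔩_n(K_∞)` and the transparency setting, as in Step1Bump
set_option backward.isDefEq.respectTransparency false in
open scoped Matrix.Norms.Operator in
/-- **`Ad K_∞`-invariant symmetric test functions of prescribed level and archimedean support.**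
For a compact open subgroup `U₀ ≤ GL_n(𝔸_K^∞)` and a neighbourhood `V` of `1` in `GL_n(K_∞)` there
is a test function `η` on `GL_n(𝔸_K)` (`IsTestFunctionGL`) with `η ≥ 0`, `η 1 = 1`,
`η(g⁻¹) = η(g)`, `η(k g k⁻¹) = η(g)` for `k ∈ K_∞ = U(n, K ⊗ ℝ)` (embedded by `GLn.ofInfinite`),
`η((1,u) g) = η(g) = η(g (1,u))` for `u ∈ U₀`, and `η(g) ≠ 0 ⟹ g_∞ ∈ V ∧ g_f ∈ U₀`.
Construction (Bump (1997), proof of Lemma 2.3.2, PDF p. 163: "`φ₀(g) = φ₀(g⁻¹)` …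
`φ₀(κ g κ⁻¹) = φ₀(g)`"; Getz–Hahn (2024), Exercise 9.7): `η(g) = archBump φ (g_∞) · 1_{U₀}(g_f)`
with the bump radius `r` of `φ` chosen by coercivity of the Hilbert–Schmidt form
(`exists_hsQ_lt_imp_norm_lt`) so that `{Q(x - 1) < r}` lies in `V` and in a ball of `M_n(K ⊗ ℝ)`
consisting of units (compact support); smoothness along `X ↦ g_∞ exp X` is
`contDiff_archBump_mul_expGL`. [cite: Bump1997, proof of Lemma 2.3.2 (PDF p. 163)] -/
theorem exists_adInvariant_isTestFunctionGL
    {U₀ : Subgroup (GL (Fin n) (FiniteAdeleRing (𝓞 K) K))}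
    (hU₀o : IsOpen (U₀ : Set (GL (Fin n) (FiniteAdeleRing (𝓞 K) K))))
    (hU₀c : IsCompact (U₀ : Set (GL (Fin n) (FiniteAdeleRing (𝓞 K) K))))
    {V : Set (GL (Fin n) (mixedSpace K))} (hV : V ∈ 𝓝 (1 : GL (Fin n) (mixedSpace K))) :
    ∃ η : GL (Fin n) (AdeleRing (𝓞 K) K) → ℝ, IsTestFunctionGL n K η ∧ 0 ≤ η ∧ η 1 = 1 ∧
      (∀ g, η g⁻¹ = η g) ∧
      (∀ k ∈ Kinf n K, ∀ g, η (GLn.ofInfinite n K k * g * (GLn.ofInfinite n K k)⁻¹) = η g) ∧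
      (∀ u ∈ U₀, ∀ g, η (GLn.ofFinite n K u * g) = η g) ∧
      (∀ u ∈ U₀, ∀ g, η (g * GLn.ofFinite n K u) = η g) ∧
      (∀ g, η g ≠ 0 → GLn.toMixed n K g ∈ V ∧ GLn.sndHom n K g ∈ U₀) := by
  -- the archimedean neighbourhood as a neighbourhood of `1` in matrices, and a ball inside it
  have hW : (Units.val '' V) ∈ 𝓝 (1 : Matrix (Fin n) (Fin n) (mixedSpace K)) := by
    have h := (Units.isOpenEmbedding_val
      (R := Matrix (Fin n) (Fin n) (mixedSpace K))).image_mem_nhds.2 hV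
    rwa [Units.val_one] at h
  obtain ⟨ε₀, hε₀, hball⟩ := Metric.mem_nhds_iff.1 hW
  -- the radius of the bump, by coercivity of `Q`
  obtain ⟨r, hr, hrε⟩ := exists_hsQ_lt_imp_norm_lt (n := n) (K := K) (half_pos hε₀)
  let φ : ContDiffBump (0 : ℝ) := ⟨r / 2, r, half_pos hr, half_lt_self hr⟩
  have hφr : φ.rOut = r := rfl
  -- `α x ≠ 0 → ‖x - 1‖ < ε₀ / 2`, hence `x ∈ V`
  have hαsupp : ∀ x : GL (Fin n) (mixedSpace K), archBump φ x ≠ 0 →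
      ‖(x : Matrix (Fin n) (Fin n) (mixedSpace K)) - 1‖ < ε₀ / 2 := fun x hx ↦
    hrε _ (hφr ▸ hsQ_lt_of_archBump_ne_zero φ hx)
  have hαV : ∀ x : GL (Fin n) (mixedSpace K), archBump φ x ≠ 0 → x ∈ V := by
    intro x hx
    have hxb : (x : Matrix (Fin n) (Fin n) (mixedSpace K)) ∈ Metric.ball 1 ε₀ := by
      rw [Metric.mem_ball, dist_eq_norm]
      linarith [hαsupp x hx, hε₀]
    obtain ⟨u, hu, hueq⟩ := hball hxb
    have : u = x := Units.ext hueq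
    rw [← this]
    exact hu
  -- the finite part: the clopen set `{g | g_f ∈ U₀}`
  have hsndc : Continuous (GLn.sndHom n K) := continuous_snd.generalLinearGroup_map
  set S : Set (GL (Fin n) (AdeleRing (𝓞 K) K)) := (GLn.sndHom n K) ⁻¹'
    (U₀ : Set (GL (Fin n) (FiniteAdeleRing (𝓞 K) K))) with hS
  have hSclopen : IsClopen S :=
    ⟨(U₀.isClosed_of_isOpen hU₀o).preimage hsndc, hU₀o.preimage hsndc⟩
  have hS_iff : ∀ g : GL (Fin n) (AdeleRing (𝓞 K) K), g ∈ S ↔ GLn.sndHom n K g ∈ U₀ :=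
    fun g ↦ Iff.rfl
  have hS_mul : ∀ (g : GL (Fin n) (AdeleRing (𝓞 K) K)) (h : GL (Fin n) (mixedSpace K)),
      g * GLn.ofInfinite n K h ∈ S ↔ g ∈ S := by
    intro g h
    rw [hS_iff, hS_iff, map_mul, GLn.sndHom_ofInfinite, mul_one]
  have hS_mul' : ∀ (g : GL (Fin n) (AdeleRing (𝓞 K) K)) (h : GL (Fin n) (mixedSpace K)),
      GLn.ofInfinite n K h * g ∈ S ↔ g ∈ S := by
    intro g h
    rw [hS_iff, hS_iff, map_mul, GLn.sndHom_ofInfinite, one_mul]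
  have hS_inv : ∀ g : GL (Fin n) (AdeleRing (𝓞 K) K), g⁻¹ ∈ S ↔ g ∈ S := by
    intro g
    rw [hS_iff, hS_iff, map_inv]
    exact Subgroup.inv_mem_iff _
  -- the function
  set η : GL (Fin n) (AdeleRing (𝓞 K) K) → ℝ := fun g ↦
    archBump φ (GLn.toMixed n K g) * S.indicator (fun _ ↦ (1 : ℝ)) g with hη
  have hη_apply : ∀ g, η g = archBump φ (GLn.toMixed n K g) * S.indicator (fun _ ↦ (1 : ℝ)) g :=
    fun g ↦ rfl
  have hind0 : ∀ g, 0 ≤ S.indicator (fun _ ↦ (1 : ℝ)) g := fun g ↦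
    Set.indicator_nonneg (fun _ _ ↦ zero_le_one) g
  have hη0 : ∀ g, 0 ≤ η g := fun g ↦ mul_nonneg (archBump_nonneg φ _) (hind0 g)
  -- support control: `η g ≠ 0 → α(g_∞) ≠ 0 ∧ g_f ∈ U₀`
  have hsupp : ∀ g, η g ≠ 0 → archBump φ (GLn.toMixed n K g) ≠ 0 ∧ GLn.sndHom n K g ∈ U₀ := by
    intro g hg
    rw [hη_apply] at hg
    have hSg : g ∈ S := by
      by_contra hgS
      rw [Set.indicator_of_notMem hgS, mul_zero] at hg
      exact hg rfl
    exact ⟨left_ne_zero_of_mul hg, (hS_iff g).1 hSg⟩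
  have hcont : Continuous η :=
    ((continuous_archBump φ).comp (GLn.continuous_toMixed n K)).mul
      (hSclopen.continuous_indicator continuous_const)
  -- compact support: `supp η ⊆ (C, 1) · ({1} × U₀)`, `C = {x | ‖x - 1‖ ≤ ε₀/2}` compact in `GL_n(K_∞)`
  have hcs : HasCompactSupport η := by
    haveI : ProperSpace (Matrix (Fin n) (Fin n) (mixedSpace K)) := FiniteDimensional.proper ℝ _
    set C : Set (GL (Fin n) (mixedSpace K)) :=
      Units.val ⁻¹' Metric.closedBall (1 : Matrix (Fin n) (Fin n) (mixedSpace K)) (ε₀ / 2) with hC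
    have hCsub : Metric.closedBall (1 : Matrix (Fin n) (Fin n) (mixedSpace K)) (ε₀ / 2) ⊆
        Set.range (Units.val :
          GL (Fin n) (mixedSpace K) → Matrix (Fin n) (Fin n) (mixedSpace K)) := by
      intro y hy
      have hyb : y ∈ Metric.ball (1 : Matrix (Fin n) (Fin n) (mixedSpace K)) ε₀ :=
        Metric.closedBall_subset_ball (half_lt_self hε₀) hy
      obtain ⟨u, -, rfl⟩ := hball hyb
      exact ⟨u, rfl⟩
    have hCc : IsCompact C :=
      (Units.isOpenEmbedding_val
        (R := Matrix (Fin n) (Fin n) (mixedSpace K))).isInducing.isCompact_preimage'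
        (isCompact_closedBall _ _) hCsub
    refine HasCompactSupport.of_support_subset_isCompact
      ((hCc.image (GLn.continuous_ofInfinite n K)).mul (hU₀c.image (GLn.continuous_ofFinite n K)))
      fun g hg ↦ ?_
    obtain ⟨hαg, h2⟩ := hsupp g hg
    have h1 : GLn.toMixed n K g ∈ C := by
      rw [hC, Set.mem_preimage, Metric.mem_closedBall, dist_eq_norm]
      exact (hαsupp _ hαg).le
    rw [← GLn.ofInfinite_toMixed_mul_ofFinite_sndHom g]
    exact Set.mul_mem_mul (Set.mem_image_of_mem _ h1) (Set.mem_image_of_mem _ h2)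
  refine ⟨η, ⟨hcont, hcs, ?_, ?_⟩, hη0, ?_, ?_, ?_, ?_, ?_, ?_⟩
  · -- archimedean smoothness
    intro (g : GL (Fin n) (AdeleRing (𝓞 K) K))
    show ContDiff ℝ ∞ fun X : (archGroupGL n K).lie.toSubmodule ↦
      ((η (g * GLn.ofInfinite n K (expGL (X : Matrix (Fin n) (Fin n) (mixedSpace K)))) : ℝ) : ℂ)
    have hconst : (fun X : (archGroupGL n K).lie.toSubmodule ↦
        ((η (g * GLn.ofInfinite n K (expGL (X : Matrix (Fin n) (Fin n) (mixedSpace K)))) : ℝ) :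
          ℂ)) =
        fun X : (archGroupGL n K).lie.toSubmodule ↦
          ((archBump φ (GLn.toMixed n K g * expGL (X : Matrix (Fin n) (Fin n) (mixedSpace K))) *
            S.indicator (fun _ ↦ (1 : ℝ)) g : ℝ) : ℂ) := by
      funext X
      rw [hη_apply, map_mul, GLn.toMixed_ofInfinite]
      congr 2
      rw [Set.indicator_apply, Set.indicator_apply]
      simp only [hS_mul]
    rw [hconst]
    have hval : ContDiff ℝ ∞ fun X : (archGroupGL n K).lie.toSubmodule ↦
        (X : Matrix (Fin n) (Fin n) (mixedSpace K)) :=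
      (archGroupGL n K).lie.toSubmodule.subtypeL.contDiff
    exact Complex.ofRealCLM.contDiff.comp
      (((contDiff_archBump_mul_expGL φ (GLn.toMixed n K g)).comp hval).mul contDiff_const)
  · -- right invariance under the level `{1} × U₀`
    refine ⟨U₀.map (GLn.ofFinite n K), ⟨U₀, hU₀o, hU₀c, rfl⟩, ?_⟩
    rintro _ ⟨u, hu, rfl⟩ g
    have hSu : g * GLn.ofFinite n K u ∈ S ↔ g ∈ S := by
      rw [hS_iff, hS_iff, map_mul, GLn.sndHom_ofFinite]
      exact Subgroup.mul_mem_cancel_right _ hu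
    rw [hη_apply, hη_apply, map_mul, GLn.toMixed_ofFinite, mul_one]
    congr 1
    rw [Set.indicator_apply, Set.indicator_apply]
    simp only [hSu]
  · -- `η 1 = 1`
    have h1S : (1 : GL (Fin n) (AdeleRing (𝓞 K) K)) ∈ S := by
      rw [hS_iff, map_one]
      exact one_mem _
    rw [hη_apply, map_one, archBump_one, Set.indicator_of_mem h1S, mul_one]
  · -- symmetry under `g ↦ g⁻¹`
    intro g
    rw [hη_apply, hη_apply, map_inv, archBump_inv]
    congr 1
    rw [Set.indicator_apply, Set.indicator_apply]
    simp only [hS_inv]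
  · -- `Ad K_∞`-invariance
    intro k hk g
    have hk' : star (k : Matrix (Fin n) (Fin n) (mixedSpace K)) * k = 1 :=
      ((archGroupGL n K).mem_maximalCompact_iff k).mp hk |>.2
    have hSk : GLn.ofInfinite n K k * g * (GLn.ofInfinite n K k)⁻¹ ∈ S ↔ g ∈ S := by
      rw [← map_inv, hS_mul, hS_mul']
    rw [hη_apply, hη_apply, map_mul, map_mul, map_inv, GLn.toMixed_ofInfinite, archBump_conj φ hk']
    congr 1
    rw [Set.indicator_apply, Set.indicator_apply]
    simp only [hSk]
  · -- left invariance under `{1} × U₀`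
    intro u hu g
    have hSu : GLn.ofFinite n K u * g ∈ S ↔ g ∈ S := by
      rw [hS_iff, hS_iff, map_mul, GLn.sndHom_ofFinite]
      exact Subgroup.mul_mem_cancel_left _ hu
    rw [hη_apply, hη_apply, map_mul, GLn.toMixed_ofFinite, one_mul]
    congr 1
    rw [Set.indicator_apply, Set.indicator_apply]
    simp only [hSu]
  · -- right invariance under `{1} × U₀`
    intro u hu g
    have hSu : g * GLn.ofFinite n K u ∈ S ↔ g ∈ S := by
      rw [hS_iff, hS_iff, map_mul, GLn.sndHom_ofFinite]
      exact Subgroup.mul_mem_cancel_right _ hu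
    rw [hη_apply, hη_apply, map_mul, GLn.toMixed_ofFinite, mul_one]
    congr 1
    rw [Set.indicator_apply, Set.indicator_apply]
    simp only [hSu]
  · -- support
    intro g hg
    obtain ⟨hαg, h2⟩ := hsupp g hg
    exact ⟨hαV _ hαg, h2⟩

end Literature.NumberTheory.Automorphic
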